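import Summits.QuantumFields.YangMills.Theorems.AllWindowsColdBoxBoxHighLineTiltCum5SizesMuSet
import Summits.QuantumFields.YangMills.Theorems.AllWindowsColdBoxBoxHighLineRestrictionSetCum4Slots
import Summits.QuantumFields.YangMills.Theorems.AllWindowsColdBoxBoxHighLineConnectedFourPointCubicMuSet

/-!
# K4′(b) ROW R2, PRELIMINARIES — collapse lemmas and the four Gaussian sizes for `κ₄(Q_x, c_y; P) + κ₄(L_x, Q_y; P)` over `μ_{D′}`
# (LEAD ym-line-sfw-p2 g78's `ym-idea-1/g78-K4PRIME-TERM-TABLE.md` §2 row R2, offered §4 to this seat; planner ym-idea-2 g18 endorsement 2026-08-30T00:46:21Z;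
#  `Cruxes/BoxWindowHighSU2213/ASSEMBLY-U5.md` §3 Steps D–E, hK4′ of `landauThirdOrder_of_sizes`; LINE-20 U5 ⟨stmt-QuantumFields-24336⟩)

Width seat `ym-line-sfw-p2-w5` (prover-ym-line-sfw-p2-w5-g24-0).  Letters = R1 ✓`EdgeChartGaussian.abs_tiltCum4_muSet_cubicPair_le`: `P := β·Σ_{p∈PT} tripleForm (Tc p) (plaqVar p ·)`
(`|Tc| ≤ B`), `L_z := linCurvSq H (plaq12At z)`, `Q_z := chartPlaqCost H z 1 2 − L_z`, `μ_{D′} := (volume.restrict D′).withDensity (ofReal ∘ gaussWeight β H)` for a measurable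
`D′ ⊆ smallField H s`, mass defect `E₀[1 − 1_{D′}] ≤ τ ≤ 1/2`.  Since `κ₄,₀(X, Y; P, P) = CROSS(X, Y; P, P)` at `t = 0` (tilt letter immaterial), fcl-p3 g27's
✓`GaussRestrict.abs_cross_muSet_zero_le_gaussAvg` (Hölder (4,4,4,4) over `μ_{D′}`, re-centring at constants, `E ≤ 2E₀[1_{D′}·]`) gives — NO parity needed —

  `|κ₄(X,Y;P)| ≤ 128·(E₀[1_{D′}(X−a₁)⁴])^{1/4}·(E₀[1_{D′}(Y−a₂)⁴])^{1/4}·(E₀[1_{D′}P⁴])^{1/2}`   (`r2_collapse`),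

and the four Gaussian sizes are tree theorems: `E₀[1_{D′}Q⁴] ≤ 8C_o s⁶/β³ + 8C₇⁴s¹⁶` (`Q = c^{odd} + evenRem`: ✓`TiltSup.gaussAvg_sfInd_odd_pow_four_le` + ✓7a
`TiltSup.abs_chartPlaqCost_even_rem_le_of wilsonPlaquetteTaylor`), `E₀[1_{D′}(c_y − m_y)⁴] ≤ C_P(L⁴/β⁴ + s⁶/β³)` (✓`gaussAvg_sfInd_mul_chartPlaqCost_sub_mean_pow_le`),
`E₀[(L_x − m_x)⁴] ≤ 81(C_vL²/β²)²` and `E₀[P⁴] ≤ 729(C_TB²H⁴L³/β)²` (Bonami–Nelson ✓`gaussAvg_pow_even_le_of_polyCert_of_le` over ✓`gaussAvg_centred_linCurvSq_sq_le` /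
✓`tripleBond_gaussAvg_le`).  Results:

THIS FILE: `r2_collapse`, `tiltCum4_zero_eq_cross` (κ₄,₀(X,Y;P,P) ≡ CROSS(X,Y;P,P)), and the four size lemmas
`gaussAvg_indicator_mul_Q_pow_four_le`, `gaussAvg_indicator_mul_chartPlaqCost_sub_mean_pow_four_le`, `gaussAvg_indicator_mul_linCurvSq_sub_mean_pow_four_le`,
`gaussAvg_indicator_mul_tripleFormSum_pow_four_le`.  The row itself (`abs_tiltCum4_muSet_rowR2_le`, `…_rpow`) is `…K4PrimeRowR2.lean`.

Tree only; no definitions; standard axioms.  HONEST LABEL: U5 prep, helper-grade (one row of hK4′); U5 ⟨24336⟩ UNSTAFFED/OPEN, ⟨24004⟩ OPEN; route AllWindowsColdBox DRAFT;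
no crux, rung or summit is proved; **the Yang–Mills mass gap is NOT proved by this file; no summit is proved by a line.**
-/

set_option autoImplicit false

noncomputable section

open MeasureTheory Set Finset
open Literature.Probability.LatticeModels (Site)
open Literature.MathematicalPhysics.QuantumLattice (ZdPlaquette plaquettesTouching)
open Literature.MathematicalPhysics.QuantumFieldTheory.AxialGauge (boxEdges)
open Summit.QuantumFields.YangMills.Theorems.WeakCouplingRates (plaq12At)

namespace Summit.QuantumFields.YangMills.Theorems.AllWindowsColdBoxBoxHighLine

namespace GaussNormalForm

open EdgeChartGaussian (polyCert_const polyCert_sub polyCert_pow polyCert_linCurvSq polyCert_tripleFormSum integrable_polyCert_mul_gaussWeight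
  measurable_of_polyCert gaussAvg_mono_of_nonneg gaussAvg_nonneg)
open LaplaceSandwich (flatten)

variable {H : ℕ} {β : ℝ}

/-! ## §1 Pure-real collapse of the Hölder bound -/

/-- **Collapse**: `4·√(√(32A_Q)·√(32A_Y))·√(√(32A_P)·√(32A_P)) ≤ 128·√√a_Q·√√a_Y·√a_P` whenever `0 ≤ A_• ≤ a_•`. -/
theorem r2_collapse {AQ AY AP aQ aY aP : ℝ} (hQ : AQ ≤ aQ) (hY : AY ≤ aY) (hP0 : 0 ≤ AP) (hP : AP ≤ aP) :
    4 * (Real.sqrt (Real.sqrt (32 * AQ) * Real.sqrt (32 * AY)) * Real.sqrt (Real.sqrt (32 * AP) * Real.sqrt (32 * AP))) ≤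
      128 * (Real.sqrt (Real.sqrt aQ) * Real.sqrt (Real.sqrt aY) * Real.sqrt aP) := by
  have h32 : Real.sqrt (Real.sqrt (32 : ℝ)) * Real.sqrt (Real.sqrt 32) = Real.sqrt 32 := Real.mul_self_sqrt (Real.sqrt_nonneg _)
  have e1 : Real.sqrt (Real.sqrt (32 * AP) * Real.sqrt (32 * AP)) = Real.sqrt 32 * Real.sqrt AP := by
    rw [Real.mul_self_sqrt (by positivity : (0 : ℝ) ≤ 32 * AP), Real.sqrt_mul (by norm_num : (0 : ℝ) ≤ 32)]
  have e2 : Real.sqrt (Real.sqrt (32 * AQ) * Real.sqrt (32 * AY)) = Real.sqrt 32 * (Real.sqrt (Real.sqrt AQ) * Real.sqrt (Real.sqrt AY)) := by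
    -- `√√(32·X) = √√32·√√X` (the tree's `Literature.Analysis.FluidPDE.sqrt_sqrt_mul`, inlined)
    have ssm : ∀ X : ℝ, Real.sqrt (Real.sqrt (32 * X)) = Real.sqrt (Real.sqrt 32) * Real.sqrt (Real.sqrt X) := fun X => by
      rw [Real.sqrt_mul (by norm_num : (0 : ℝ) ≤ 32), Real.sqrt_mul (Real.sqrt_nonneg _)]
    rw [Real.sqrt_mul (Real.sqrt_nonneg _), ssm, ssm]
    linear_combination (Real.sqrt (Real.sqrt AQ) * Real.sqrt (Real.sqrt AY)) * h32
  rw [e1, e2]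
  have h32sq : Real.sqrt 32 * Real.sqrt 32 = (32 : ℝ) := Real.mul_self_sqrt (by norm_num)
  have m1 : Real.sqrt (Real.sqrt AQ) ≤ Real.sqrt (Real.sqrt aQ) := Real.sqrt_le_sqrt (Real.sqrt_le_sqrt hQ)
  have m2 : Real.sqrt (Real.sqrt AY) ≤ Real.sqrt (Real.sqrt aY) := Real.sqrt_le_sqrt (Real.sqrt_le_sqrt hY)
  have m3 : Real.sqrt AP ≤ Real.sqrt aP := Real.sqrt_le_sqrt hP
  have m12 := mul_le_mul m1 m2 (Real.sqrt_nonneg _) (Real.sqrt_nonneg _)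
  have m123 := mul_le_mul m12 m3 (Real.sqrt_nonneg _) (mul_nonneg (Real.sqrt_nonneg _) (Real.sqrt_nonneg _))
  calc 4 * (Real.sqrt 32 * (Real.sqrt (Real.sqrt AQ) * Real.sqrt (Real.sqrt AY)) * (Real.sqrt 32 * Real.sqrt AP))
      = 4 * (Real.sqrt 32 * Real.sqrt 32) * (Real.sqrt (Real.sqrt AQ) * Real.sqrt (Real.sqrt AY) * Real.sqrt AP) := by ring
    _ = 128 * (Real.sqrt (Real.sqrt AQ) * Real.sqrt (Real.sqrt AY) * Real.sqrt AP) := by rw [h32sq]; ring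
    _ ≤ 128 * (Real.sqrt (Real.sqrt aQ) * Real.sqrt (Real.sqrt aY) * Real.sqrt aP) := mul_le_mul_of_nonneg_left m123 (by norm_num)

/-- `κ₄,₀(X, Y; P, P)` IS the CROSS term at `U = V = P` (definitional up to `x² = x·x` and `2ab = ab + ab`). -/
theorem tiltCum4_zero_eq_cross {Ω : Type*} [MeasurableSpace Ω] (μ : Measure Ω) (P X Y : Ω → ℝ) :
    Tilt.tiltCum4 μ P 0 X Y =
      Tilt.tiltExp μ P 0 (fun a => (X a - Tilt.tiltExp μ P 0 X) * (Y a - Tilt.tiltExp μ P 0 Y) * (P a - Tilt.tiltExp μ P 0 P) * (P a - Tilt.tiltExp μ P 0 P)) -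
        Tilt.tiltExp μ P 0 (fun a => (X a - Tilt.tiltExp μ P 0 X) * (Y a - Tilt.tiltExp μ P 0 Y)) *
          Tilt.tiltExp μ P 0 (fun a => (P a - Tilt.tiltExp μ P 0 P) * (P a - Tilt.tiltExp μ P 0 P)) -
        Tilt.tiltExp μ P 0 (fun a => (X a - Tilt.tiltExp μ P 0 X) * (P a - Tilt.tiltExp μ P 0 P)) *
          Tilt.tiltExp μ P 0 (fun a => (Y a - Tilt.tiltExp μ P 0 Y) * (P a - Tilt.tiltExp μ P 0 P)) -
        Tilt.tiltExp μ P 0 (fun a => (X a - Tilt.tiltExp μ P 0 X) * (P a - Tilt.tiltExp μ P 0 P)) *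
          Tilt.tiltExp μ P 0 (fun a => (Y a - Tilt.tiltExp μ P 0 Y) * (P a - Tilt.tiltExp μ P 0 P)) := by
  unfold Tilt.tiltCum4
  have e1 : (fun a => (X a - Tilt.tiltExp μ P 0 X) * (Y a - Tilt.tiltExp μ P 0 Y) * (P a - Tilt.tiltExp μ P 0 P) ^ 2) =
      fun a => (X a - Tilt.tiltExp μ P 0 X) * (Y a - Tilt.tiltExp μ P 0 Y) * (P a - Tilt.tiltExp μ P 0 P) * (P a - Tilt.tiltExp μ P 0 P) := by
    funext a; ring
  have e2 : (fun a => (P a - Tilt.tiltExp μ P 0 P) ^ 2) = fun a => (P a - Tilt.tiltExp μ P 0 P) * (P a - Tilt.tiltExp μ P 0 P) := by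
    funext a; ring
  rw [e1, e2]; ring

/-! ## §2 The four Gaussian sizes -/

/-- **`E₀[1_{D′}·Q_z⁴] ≤ 8·C_o·s⁶/β³ + 8·C₇⁴·s¹⁶`** (`Q = c^{odd} + evenRem`; `D′ ⊆ smallField H s`, `H ≥ 1`, `β ≥ 1`, `0 ≤ s ≤ 1`). -/
theorem gaussAvg_indicator_mul_Q_pow_four_le : ∃ C : ℝ, 0 ≤ C ∧ ∀ H : ℕ, 1 ≤ H → ∀ β : ℝ, 1 ≤ β → ∀ s : ℝ, 0 ≤ s → s ≤ 1 →
    ∀ D : Set (LandauFree H → E3), D ⊆ smallField H s → ∀ z : Site 4,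
      gaussAvg β H (fun a => D.indicator (fun _ => (1 : ℝ)) a * (chartPlaqCost H z 1 2 a - linCurvSq H (plaq12At z) a - 0) ^ 4) ≤
        C * (s ^ 6 / β ^ 3 + s ^ 16) := by
  obtain ⟨C_o, hCo0, hO4⟩ := TiltSup.gaussAvg_sfInd_odd_pow_four_le
  obtain ⟨C₇, h7⟩ := TiltSup.abs_chartPlaqCost_even_rem_le_of wilsonPlaquetteTaylor
  refine ⟨8 * C_o + 8 * (max C₇ 0) ^ 4, by positivity, fun H hH β hβ s hs0 hs1 D hDs z => ?_⟩
  have hβ0 : 0 < β := lt_of_lt_of_le one_pos hβ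
  -- pointwise on `D`: `Q⁴ ≤ 8(c^{odd})⁴ + 8·evenRem⁴ ≤ 8·sfInd·(c^{odd})⁴ + 8(C₇ s⁴)⁴`
  have hdom : ∀ a, D.indicator (fun _ => (1 : ℝ)) a * (chartPlaqCost H z 1 2 a - linCurvSq H (plaq12At z) a - 0) ^ 4 ≤
      8 * (sfInd H s a * chartPlaqCostOdd H z 1 2 a ^ 4) + 8 * (max C₇ 0 * s ^ 4) ^ 4 := by
    intro a
    by_cases ha : a ∈ D
    · have has : a ∈ smallField H s := hDs ha
      rw [Set.indicator_of_mem ha, one_mul, sub_zero, sfInd, Set.indicator_of_mem has, one_mul]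
      have hr : |chartPlaqCost H z 1 2 a - linCurvSq H (plaq12At z) a - chartPlaqCostOdd H z 1 2 a| ≤ max C₇ 0 * s ^ 4 :=
        (h7 H s hs0 hs1 a has z 1 2 (by decide)).trans (mul_le_mul_of_nonneg_right (le_max_left _ _) (by positivity))
      have e : chartPlaqCost H z 1 2 a - linCurvSq H (plaq12At z) a =
          chartPlaqCostOdd H z 1 2 a + (chartPlaqCost H z 1 2 a - linCurvSq H (plaq12At z) a - chartPlaqCostOdd H z 1 2 a) := by ring
      rw [e]
      have hpm := add_pow_le (abs_nonneg (chartPlaqCostOdd H z 1 2 a))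
        (abs_nonneg (chartPlaqCost H z 1 2 a - linCurvSq H (plaq12At z) a - chartPlaqCostOdd H z 1 2 a)) 4
      have htri : |chartPlaqCostOdd H z 1 2 a + (chartPlaqCost H z 1 2 a - linCurvSq H (plaq12At z) a - chartPlaqCostOdd H z 1 2 a)| ≤
          |chartPlaqCostOdd H z 1 2 a| + |chartPlaqCost H z 1 2 a - linCurvSq H (plaq12At z) a - chartPlaqCostOdd H z 1 2 a| := abs_add_le _ _
      have hE : Even 4 := by decide
      calc (chartPlaqCostOdd H z 1 2 a + (chartPlaqCost H z 1 2 a - linCurvSq H (plaq12At z) a - chartPlaqCostOdd H z 1 2 a)) ^ 4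
          = |chartPlaqCostOdd H z 1 2 a + (chartPlaqCost H z 1 2 a - linCurvSq H (plaq12At z) a - chartPlaqCostOdd H z 1 2 a)| ^ 4 :=
            (hE.pow_abs _).symm
        _ ≤ (|chartPlaqCostOdd H z 1 2 a| + |chartPlaqCost H z 1 2 a - linCurvSq H (plaq12At z) a - chartPlaqCostOdd H z 1 2 a|) ^ 4 :=
            pow_le_pow_left₀ (abs_nonneg _) htri 4
        _ ≤ 2 ^ (4 - 1) * (|chartPlaqCostOdd H z 1 2 a| ^ 4 + |chartPlaqCost H z 1 2 a - linCurvSq H (plaq12At z) a - chartPlaqCostOdd H z 1 2 a| ^ 4) := hpm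
        _ = 8 * chartPlaqCostOdd H z 1 2 a ^ 4 + 8 * |chartPlaqCost H z 1 2 a - linCurvSq H (plaq12At z) a - chartPlaqCostOdd H z 1 2 a| ^ 4 := by
            rw [hE.pow_abs]; norm_num; ring
        _ ≤ 8 * chartPlaqCostOdd H z 1 2 a ^ 4 + 8 * (max C₇ 0 * s ^ 4) ^ 4 := by
            have := pow_le_pow_left₀ (abs_nonneg _) hr 4; linarith
    · rw [Set.indicator_of_notMem ha, zero_mul]
      have h1 : 0 ≤ sfInd H s a * chartPlaqCostOdd H z 1 2 a ^ 4 := mul_nonneg (TiltSup.sfInd_nonneg_le_one (H := H) s a).1 (by positivity)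
      positivity
  -- integrability of the majorant
  have hiO : Integrable (fun a : LandauFree H → E3 => sfInd H s a * chartPlaqCostOdd H z 1 2 a ^ 4 * gaussWeight β H a) :=
    Tilt.integrable_bdd_mul_gaussWeight H hβ0 ((Tilt.measurable_sfInd H s).mul ((EdgeChartGaussian.measurable_chartPlaqCostOdd H z 1 2).pow_const 4))
      (C := 4 ^ 4) fun a => by
        rw [abs_mul, abs_of_nonneg (TiltSup.sfInd_nonneg_le_one (H := H) s a).1, abs_pow]
        calc sfInd H s a * |chartPlaqCostOdd H z 1 2 a| ^ 4 ≤ 1 * |chartPlaqCostOdd H z 1 2 a| ^ 4 :=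
            mul_le_mul_of_nonneg_right (TiltSup.sfInd_nonneg_le_one (H := H) s a).2 (by positivity)
          _ ≤ 4 ^ 4 := by rw [one_mul]; exact pow_le_pow_left₀ (abs_nonneg _) (PlaqObsL2.abs_chartPlaqCostOdd_le_four H z 1 2 a) 4
  have hiMaj : Integrable (fun a : LandauFree H → E3 =>
      (8 * (sfInd H s a * chartPlaqCostOdd H z 1 2 a ^ 4) + 8 * (max C₇ 0 * s ^ 4) ^ 4) * gaussWeight β H a) :=
    ((hiO.const_mul 8).add ((EdgeChartGaussian.integrable_gaussWeight H hβ0).const_mul (8 * (max C₇ 0 * s ^ 4) ^ 4))).congr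
      (Filter.Eventually.of_forall fun a => by simp only [Pi.add_apply]; ring)
  have hO := hO4 H hH β hβ s hs0 hs1 z
  calc gaussAvg β H (fun a => D.indicator (fun _ => (1 : ℝ)) a * (chartPlaqCost H z 1 2 a - linCurvSq H (plaq12At z) a - 0) ^ 4)
      ≤ gaussAvg β H (fun a => 8 * (sfInd H s a * chartPlaqCostOdd H z 1 2 a ^ 4) + 8 * (max C₇ 0 * s ^ 4) ^ 4) :=
        gaussAvg_mono_of_nonneg H hβ0 (fun a => mul_nonneg (GaussRestrict.indicator_one_nonneg_le_one D a).1 (by positivity)) hdom hiMaj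
    _ = 8 * gaussAvg β H (fun a => sfInd H s a * chartPlaqCostOdd H z 1 2 a ^ 4) + 8 * (max C₇ 0 * s ^ 4) ^ 4 := by
        rw [EdgeChartGaussian.gaussAvg_add β H (hiO.const_mul 8 |>.congr (Filter.Eventually.of_forall fun a => by ring))
          ((EdgeChartGaussian.integrable_gaussWeight H hβ0).const_mul _), EdgeChartGaussian.gaussAvg_const_mul,
          EdgeChartGaussian.gaussAvg_const_fun H hβ0]
    _ ≤ 8 * (C_o * s ^ 6 / β ^ 3) + 8 * (max C₇ 0 * s ^ 4) ^ 4 := by linarith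
    _ ≤ (8 * C_o + 8 * (max C₇ 0) ^ 4) * (s ^ 6 / β ^ 3 + s ^ 16) := by
        have h1 : 0 ≤ 8 * C_o * s ^ 16 + 8 * (max C₇ 0) ^ 4 * (s ^ 6 / β ^ 3) := by positivity
        have e : (8 * C_o + 8 * (max C₇ 0) ^ 4) * (s ^ 6 / β ^ 3 + s ^ 16) =
            (8 * (C_o * s ^ 6 / β ^ 3) + 8 * (max C₇ 0 * s ^ 4) ^ 4) + (8 * C_o * s ^ 16 + 8 * (max C₇ 0) ^ 4 * (s ^ 6 / β ^ 3)) := by ring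
        rw [e]; linarith only [h1]

/-- **`E₀[1_{D′}·(c_z − m_z)⁴] ≤ C_P·((1+log H)⁴/β⁴ + s⁶/β³)`** at `m_z = E₀[L_z]` (monotone from ✓`gaussAvg_sfInd_mul_chartPlaqCost_sub_mean_pow_le`). -/
theorem gaussAvg_indicator_mul_chartPlaqCost_sub_mean_pow_four_le : ∃ C : ℝ, 0 ≤ C ∧ ∀ H : ℕ, 1 ≤ H → ∀ β : ℝ, 1 ≤ β → ∀ s : ℝ, 0 ≤ s → s ≤ 1 →
    ∀ D : Set (LandauFree H → E3), D ⊆ smallField H s → ∀ z : Site 4,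
      gaussAvg β H (fun a => D.indicator (fun _ => (1 : ℝ)) a * (chartPlaqCost H z 1 2 a - gaussAvg β H (linCurvSq H (plaq12At z))) ^ 4) ≤
        C * ((1 + Real.log H) ^ 4 / β ^ 4 + s ^ 6 / β ^ 3) := by
  obtain ⟨C_P, hCP0, hP⟩ := gaussAvg_sfInd_mul_chartPlaqCost_sub_mean_pow_le
  refine ⟨C_P, hCP0, fun H hH β hβ s hs0 hs1 D hDs z => ?_⟩
  have hβ0 : 0 < β := lt_of_lt_of_le one_pos hβ
  have hind : ∀ a, 0 ≤ D.indicator (fun _ => (1 : ℝ)) a ∧ D.indicator (fun _ => (1 : ℝ)) a ≤ sfInd H s a := by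
    intro a
    by_cases ha : a ∈ D
    · rw [Set.indicator_of_mem ha, sfInd, Set.indicator_of_mem (hDs ha)]; norm_num
    · rw [Set.indicator_of_notMem ha]; exact ⟨le_rfl, (TiltSup.sfInd_nonneg_le_one (H := H) s a).1⟩
  have hbd : ∀ a, |chartPlaqCost H z 1 2 a - gaussAvg β H (linCurvSq H (plaq12At z))| ≤ 4 + |gaussAvg β H (linCurvSq H (plaq12At z))| :=
    fun a => (abs_sub _ _).trans (add_le_add (TiltSup.abs_chartPlaqCost_le_four (H := H) z 1 2 a) le_rfl)
  have hY : Measurable fun a => sfInd H s a * (chartPlaqCost H z 1 2 a - gaussAvg β H (linCurvSq H (plaq12At z))) ^ 4 :=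
    (Tilt.measurable_sfInd H s).mul (((EdgeChartGaussian.measurable_chartPlaqCost H z 1 2).sub measurable_const).pow_const 4)
  have hYb : ∀ a, |sfInd H s a * (chartPlaqCost H z 1 2 a - gaussAvg β H (linCurvSq H (plaq12At z))) ^ 4| ≤
      (4 + |gaussAvg β H (linCurvSq H (plaq12At z))|) ^ 4 := by
    intro a
    rw [abs_mul, abs_of_nonneg (TiltSup.sfInd_nonneg_le_one (H := H) s a).1]
    calc sfInd H s a * |(chartPlaqCost H z 1 2 a - gaussAvg β H (linCurvSq H (plaq12At z))) ^ 4|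
        ≤ 1 * |(chartPlaqCost H z 1 2 a - gaussAvg β H (linCurvSq H (plaq12At z))) ^ 4| :=
          mul_le_mul_of_nonneg_right (TiltSup.sfInd_nonneg_le_one (H := H) s a).2 (abs_nonneg _)
      _ ≤ (4 + |gaussAvg β H (linCurvSq H (plaq12At z))|) ^ 4 := by rw [one_mul]; exact Tilt.abs_pow_le_pow hbd 4 a
  have hE : Even 4 := by decide
  exact (gaussAvg_mono_of_nonneg H hβ0 (fun a => mul_nonneg (hind a).1 (hE.pow_nonneg _))
    (fun a => mul_le_mul_of_nonneg_right (hind a).2 (hE.pow_nonneg _)) (Tilt.integrable_bdd_mul_gaussWeight H hβ0 hY hYb)).trans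
    (hP H hH β hβ s hs0 hs1 z).2

/-- **`E₀[1_{D′}·(L_z − m_z)⁴] ≤ 81·(C_v(1+log H)²/β²)²`** (Bonami–Nelson on the centred quadratic `L_z − m_z`, ✓`gaussAvg_centred_linCurvSq_sq_le`). -/
theorem gaussAvg_indicator_mul_linCurvSq_sub_mean_pow_four_le : ∃ C : ℝ, 0 ≤ C ∧ ∀ H : ℕ, 1 ≤ H → ∀ β : ℝ, 0 < β →
    ∀ D : Set (LandauFree H → E3), ∀ z : Site 4,
      gaussAvg β H (fun a => D.indicator (fun _ => (1 : ℝ)) a * (linCurvSq H (plaq12At z) a - gaussAvg β H (linCurvSq H (plaq12At z))) ^ 4) ≤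
        C * ((1 + Real.log H) ^ 4 / β ^ 4) := by
  obtain ⟨Cv, hCv0, hV⟩ := EdgeChartGaussian.gaussAvg_centred_linCurvSq_sq_le
  refine ⟨81 * Cv ^ 2, by positivity, fun H hH β hβ D z => ?_⟩
  have hc : ∃ Q : MvPolynomial (LandauFree H × Fin 3) ℝ, Q.totalDegree ≤ 2 ∧
      ∀ a, linCurvSq H (plaq12At z) a - gaussAvg β H (linCurvSq H (plaq12At z)) = MvPolynomial.eval (flatten (LandauFree H) a) Q :=
    polyCert_sub (polyCert_linCurvSq H _) (polyCert_const _ 2)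
  have h4 := gaussAvg_pow_even_le_of_polyCert_of_le H hβ hc (hV H hH β hβ (plaq12At z)) 2 (by norm_num)
  have hE : Even 4 := by decide
  have hmono : gaussAvg β H (fun a => D.indicator (fun _ => (1 : ℝ)) a * (linCurvSq H (plaq12At z) a - gaussAvg β H (linCurvSq H (plaq12At z))) ^ 4) ≤
      gaussAvg β H (fun a => (linCurvSq H (plaq12At z) a - gaussAvg β H (linCurvSq H (plaq12At z))) ^ (2 * 2)) := by
    refine gaussAvg_mono_of_nonneg H hβ (fun a => mul_nonneg (GaussRestrict.indicator_one_nonneg_le_one D a).1 (hE.pow_nonneg _))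
      (fun a => ?_) (integrable_polyCert_mul_gaussWeight H hβ (polyCert_pow hc (2 * 2)))
    calc D.indicator (fun _ => (1 : ℝ)) a * (linCurvSq H (plaq12At z) a - gaussAvg β H (linCurvSq H (plaq12At z))) ^ 4
        ≤ 1 * (linCurvSq H (plaq12At z) a - gaussAvg β H (linCurvSq H (plaq12At z))) ^ 4 :=
          mul_le_mul_of_nonneg_right (GaussRestrict.indicator_one_nonneg_le_one D a).2 (hE.pow_nonneg _)
      _ = _ := by rw [one_mul]
  refine hmono.trans (h4.trans (le_of_eq ?_))
  norm_num; ring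

/-- **`E₀[1_{D′}·(P − 0)⁴] ≤ 729·(C_T·B²·H⁴(1+log H)³/β)²`** (Bonami–Nelson on the degree-3 polynomial `P`, ✓`tripleBond_gaussAvg_le`). -/
theorem gaussAvg_indicator_mul_tripleFormSum_pow_four_le : ∃ C : ℝ, 0 ≤ C ∧ ∀ H : ℕ, 1 ≤ H → ∀ β : ℝ, 0 < β → ∀ B : ℝ,
    ∀ Tc : ZdPlaquette 4 → Fin 4 → Fin 4 → Fin 4 → ℝ, (∀ p i j k, |Tc p i j k| ≤ B) → ∀ D : Set (LandauFree H → E3),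
      gaussAvg β H (fun a => D.indicator (fun _ => (1 : ℝ)) a *
        (β * ∑ p ∈ plaquettesTouching (boxEdges 4 (2 * H + 1)), tripleForm (Tc p) (plaqVar H p.1 p.2.1.1 p.2.1.2 a) - 0) ^ 4) ≤
        C * (B ^ 2 * (H : ℝ) ^ 4 * (1 + Real.log H) ^ 3 / β) ^ 2 := by
  obtain ⟨CT, hTB⟩ := EdgeChartGaussian.tripleBond_gaussAvg_le
  refine ⟨729 * (max CT 0) ^ 2, by positivity, fun H hH β hβ B Tc hT D => ?_⟩
  have hcP := polyCert_tripleFormSum H β (plaquettesTouching (boxEdges 4 (2 * H + 1))) Tc hT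
  have hB2 : gaussAvg β H (fun a => (β * ∑ p ∈ plaquettesTouching (boxEdges 4 (2 * H + 1)), tripleForm (Tc p) (plaqVar H p.1 p.2.1.1 p.2.1.2 a)) ^ 2) ≤
      max CT 0 * B ^ 2 * (H : ℝ) ^ 4 * (1 + Real.log H) ^ 3 / β := by
    refine (hTB H hH β hβ B Tc hT).trans ?_
    have hL : 0 ≤ 1 + Real.log (H : ℝ) := by
      have : (1 : ℝ) ≤ H := by exact_mod_cast hH
      have := Real.log_nonneg this; linarith
    exact div_le_div_of_nonneg_right (mul_le_mul_of_nonneg_right (mul_le_mul_of_nonneg_right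
      (mul_le_mul_of_nonneg_right (le_max_left _ _) (sq_nonneg _)) (by positivity)) (by positivity)) hβ.le
  have h4 := gaussAvg_pow_even_le_of_polyCert_of_le H hβ hcP hB2 2 (by norm_num)
  have hE : Even 4 := by decide
  have hmono : gaussAvg β H (fun a => D.indicator (fun _ => (1 : ℝ)) a *
      (β * ∑ p ∈ plaquettesTouching (boxEdges 4 (2 * H + 1)), tripleForm (Tc p) (plaqVar H p.1 p.2.1.1 p.2.1.2 a) - 0) ^ 4) ≤
      gaussAvg β H (fun a => (β * ∑ p ∈ plaquettesTouching (boxEdges 4 (2 * H + 1)), tripleForm (Tc p) (plaqVar H p.1 p.2.1.1 p.2.1.2 a)) ^ (2 * 2)) := by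
    refine gaussAvg_mono_of_nonneg H hβ (fun a => mul_nonneg (GaussRestrict.indicator_one_nonneg_le_one D a).1 (hE.pow_nonneg _))
      (fun a => ?_) (integrable_polyCert_mul_gaussWeight H hβ (polyCert_pow hcP (2 * 2)))
    rw [sub_zero]
    calc D.indicator (fun _ => (1 : ℝ)) a * (β * ∑ p ∈ plaquettesTouching (boxEdges 4 (2 * H + 1)), tripleForm (Tc p) (plaqVar H p.1 p.2.1.1 p.2.1.2 a)) ^ 4
        ≤ 1 * (β * ∑ p ∈ plaquettesTouching (boxEdges 4 (2 * H + 1)), tripleForm (Tc p) (plaqVar H p.1 p.2.1.1 p.2.1.2 a)) ^ 4 :=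
          mul_le_mul_of_nonneg_right (GaussRestrict.indicator_one_nonneg_le_one D a).2 (hE.pow_nonneg _)
      _ = _ := by rw [one_mul]
  refine hmono.trans (h4.trans (le_of_eq ?_))
  norm_num; ring


end GaussNormalForm

end Summit.QuantumFields.YangMills.Theorems.AllWindowsColdBoxBoxHighLine

end
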